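import Summits.NavierStokesRegularity.TurbBounds.LadderTail
import HarnessLib

/-!
# Row P2-R0 tail lemma, part 1 — the `ℓ²` split inequality for the truncation `(N, P) = (4, 0)` (rbsdp SPEC 3.5–3.7)
(cell `pub-turb` / `turb-bounds`; v2 staging of R-T / R-P2d for the literal P2-R0 element rule.)

HONEST FRAMING: rigorous bounds for the stated PDE and boundary conditions; no claim about physical turbulence beyond the bound.
PURE SEQUENCE ALGEBRA. Given the Legendre coefficient sequences `c` (of `V''`), `a` (of `V'`), `b` (of `V`), `d` (of `Θ'`),
`e` (of `Θ`) linked by the integration ladders (`IsLadder c a`, `IsLadder a b`, `IsLadder d e`), the Parseval form of the layer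
functional — `(s-1)[16u Σ w c² + 8 Σ w a² + v Σ w b²] + s[4 Σ w d² + v Σ w e²] + 2ĝ₀ Σ w b e` (`u = 1/K`, `v = K`) — is bounded
BELOW by its tracked finite part (`c_0..c_6`, `a_0..a_5`, `b_0..b_4`, `d_0..d_5`, `e_0..e_4`) minus the Young/tail corrections of
SPEC 3.6, plus the two slack terms `(16u(s-1) - Tελ_W)·‖tail of V'' from 7‖²` and `(4s - Tλ_T/ε)·‖tail of Θ' from 6‖²`
(`λ_T = lam 4 = 4/165`, `λ_W = lam 4 · lam 5 = 16/36465`): theorem `seq_split`. Ingredients: dropping three nonnegative tails,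
termwise Young `2|ĝ₀ b e| ≤ T(ε b² + e²/ε)`, and three instances of `LadderTail.tail_bound` (`J = 4` twice, `J = 5` once).
-/

set_option linter.style.longLine false

namespace Summit.NavierStokesRegularity.TurbBounds.TailP2R0

open Finset Summit.NavierStokesRegularity.TurbBounds.LadderTail

/-- Termwise Young bound for the coupling tail: `2 ĝ₀ w b e ≥ -T·w·(ε b² + e²/ε)` when `|ĝ₀| ≤ T`, `ε > 0`, `w ≥ 0`. -/
theorem coupling_term_bound {g0 T ε wn b e : ℝ} (hg : |g0| ≤ T) (hε : 0 < ε) (hw : 0 ≤ wn) :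
    -(T * wn * (ε * b ^ 2 + e ^ 2 / ε)) ≤ 2 * g0 * (wn * b * e) := by
  have hT : 0 ≤ T := le_trans (abs_nonneg _) hg
  -- 2|b||e| ≤ ε b² + e²/ε
  have hy : 2 * |b| * |e| ≤ ε * b ^ 2 + e ^ 2 / ε := by
    have h := sq_nonneg (ε * |b| - |e|)
    have hε' : ε ≠ 0 := hε.ne'
    have : ε * b ^ 2 + e ^ 2 / ε - 2 * |b| * |e| = (ε * |b| - |e|) ^ 2 / ε := by
      field_simp
      rw [← sq_abs b, ← sq_abs e]
      ring
    have h2 : 0 ≤ (ε * |b| - |e|) ^ 2 / ε := div_nonneg h hε.le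
    linarith
  -- |2 g0 b e| ≤ T (ε b² + e²/ε)
  have habs : |2 * g0 * (b * e)| ≤ T * (ε * b ^ 2 + e ^ 2 / ε) := by
    rw [abs_mul, abs_mul, abs_mul, abs_two]
    calc 2 * |g0| * (|b| * |e|) = |g0| * (2 * |b| * |e|) := by ring
      _ ≤ T * (ε * b ^ 2 + e ^ 2 / ε) := mul_le_mul hg hy (by positivity) hT
  have hlow := neg_abs_le (2 * g0 * (b * e))
  have : -(T * (ε * b ^ 2 + e ^ 2 / ε)) ≤ 2 * g0 * (b * e) := by linarith
  have := mul_le_mul_of_nonneg_left this hw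
  nlinarith [this]

/-- **The `ℓ²` split inequality for `(N, P) = (4, 0)`** (rbsdp SPEC 3.5–3.7 on coefficient sequences). -/
theorem seq_split {c a b d e : ℕ → ℝ} (hA : IsLadder c a) (hB : IsLadder a b) (hE : IsLadder d e)
    {s u v ε g0 T : ℝ} (hs : 1 ≤ s) (hv : 0 ≤ v) (hε : 0 < ε) (hg : |g0| ≤ T) (L : ℕ) :
    ((s - 1) * (16 * u * ∑ n ∈ range 7, w n * c n ^ 2 + 8 * ∑ n ∈ range 6, w n * a n ^ 2 + v * ∑ n ∈ range 5, w n * b n ^ 2)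
      + s * (4 * ∑ n ∈ range 6, w n * d n ^ 2 + v * ∑ n ∈ range 5, w n * e n ^ 2)
      + 2 * g0 * ∑ n ∈ range 5, w n * b n * e n
      - T * ε * (phi 4 * a 4 ^ 2 + phi 5 * a 5 ^ 2 + lam 4 * (phi 5 * c 5 ^ 2 + phi 6 * c 6 ^ 2))
      - T / ε * (phi 4 * d 4 ^ 2 + phi 5 * d 5 ^ 2))
    + (16 * u * (s - 1) - T * ε * (lam 4 * lam 5)) * ∑ k ∈ range (L + 2), w (7 + k) * c (7 + k) ^ 2
    + (4 * s - T * lam 4 / ε) * ∑ k ∈ range (L + 2), w (6 + k) * d (6 + k) ^ 2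
    ≤ (s - 1) * (16 * u * (∑ n ∈ range 7, w n * c n ^ 2 + ∑ k ∈ range (L + 2), w (7 + k) * c (7 + k) ^ 2)
            + 8 * (∑ n ∈ range 6, w n * a n ^ 2 + ∑ k ∈ range (L + 2), w (6 + k) * a (6 + k) ^ 2)
            + v * (∑ n ∈ range 5, w n * b n ^ 2 + ∑ k ∈ range (L + 2), w (5 + k) * b (5 + k) ^ 2))
      + s * (4 * (∑ n ∈ range 6, w n * d n ^ 2 + ∑ k ∈ range (L + 2), w (6 + k) * d (6 + k) ^ 2)
            + v * (∑ n ∈ range 5, w n * e n ^ 2 + ∑ k ∈ range (L + 2), w (5 + k) * e (5 + k) ^ 2))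
      + 2 * g0 * (∑ n ∈ range 5, w n * b n * e n + ∑ k ∈ range (L + 2), w (5 + k) * b (5 + k) * e (5 + k)) := by
  -- names for the tails
  set Rc := ∑ k ∈ range (L + 2), w (7 + k) * c (7 + k) ^ 2 with hRc
  set Ra := ∑ k ∈ range (L + 2), w (6 + k) * a (6 + k) ^ 2 with hRa
  set Rb := ∑ k ∈ range (L + 2), w (5 + k) * b (5 + k) ^ 2 with hRb
  set Rd := ∑ k ∈ range (L + 2), w (6 + k) * d (6 + k) ^ 2 with hRd
  set Re := ∑ k ∈ range (L + 2), w (5 + k) * e (5 + k) ^ 2 with hRe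
  set Rbe := ∑ k ∈ range (L + 2), w (5 + k) * b (5 + k) * e (5 + k) with hRbe
  have hs1 : 0 ≤ s - 1 := by linarith
  have hs0 : 0 ≤ s := by linarith
  have hT : 0 ≤ T := le_trans (abs_nonneg _) hg
  have hnn : ∀ (f : ℕ → ℝ) (j : ℕ), 0 ≤ ∑ k ∈ range (L + 2), w (j + k) * f (j + k) ^ 2 := fun f j =>
    sum_nonneg fun k _ => mul_nonneg (w_pos _).le (sq_nonneg _)
  have hRa0 : 0 ≤ Ra := hnn a 6
  have hRb0 : 0 ≤ Rb := hnn b 5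
  have hRc0 : 0 ≤ Rc := hnn c 7
  have hRd0 : 0 ≤ Rd := hnn d 6
  have hRe0 : 0 ≤ Re := hnn e 5
  -- (ii) coupling tail ≥ -T(ε Rb + Re/ε)
  have hcoup : -(T * (ε * Rb + Re / ε)) ≤ 2 * g0 * Rbe := by
    have h : ∀ k ∈ range (L + 2),
        -(T * w (5 + k) * (ε * b (5 + k) ^ 2 + e (5 + k) ^ 2 / ε)) ≤ 2 * g0 * (w (5 + k) * b (5 + k) * e (5 + k)) :=
      fun k _ => coupling_term_bound hg hε (w_pos _).le
    have hsum := sum_le_sum h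
    rw [← mul_sum] at hsum
    have e1 : ∑ k ∈ range (L + 2), -(T * w (5 + k) * (ε * b (5 + k) ^ 2 + e (5 + k) ^ 2 / ε))
        = -(T * (ε * Rb + Re / ε)) := by
      rw [hRb, hRe, mul_sum, sum_div, ← sum_add_distrib, mul_sum, ← sum_neg_distrib]
      refine sum_congr rfl fun k _ => ?_
      ring
    rw [e1] at hsum
    exact hsum
  -- (iii) the three ladder tail bounds
  have e54 : ∀ k, 4 + 1 + k = 5 + k := fun k => by omega
  have e64 : ∀ k, 4 + 2 + k = 6 + k := fun k => by omega
  have e65 : ∀ k, 5 + 1 + k = 6 + k := fun k => by omega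
  have e75 : ∀ k, 5 + 2 + k = 7 + k := fun k => by omega
  have hT1 : Re ≤ phi 4 * d 4 ^ 2 + phi 5 * d 5 ^ 2 + lam 4 * Rd := by
    have h := tail_bound hE 4 L
    simp only [e54, e64] at h
    exact h
  have hT2 : Rb ≤ phi 4 * a 4 ^ 2 + phi 5 * a 5 ^ 2 + lam 4 * Ra := by
    have h := tail_bound hB 4 L
    simp only [e54, e64] at h
    exact h
  have hT3 : Ra ≤ phi 5 * c 5 ^ 2 + phi 6 * c 6 ^ 2 + lam 5 * Rc := by
    have h := tail_bound hA 5 L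
    simp only [e65, e75] at h
    exact h
  -- (iv) scale the tail bounds
  have hTε : 0 ≤ T * ε := mul_nonneg hT hε.le
  have hTε' : 0 ≤ T / ε := div_nonneg hT hε.le
  have hl4 : 0 ≤ lam 4 := (lam_pos 4).le
  have hW : T * ε * Rb ≤ T * ε * (phi 4 * a 4 ^ 2 + phi 5 * a 5 ^ 2 + lam 4 * (phi 5 * c 5 ^ 2 + phi 6 * c 6 ^ 2 + lam 5 * Rc)) := by
    refine mul_le_mul_of_nonneg_left (hT2.trans ?_) hTε
    have := mul_le_mul_of_nonneg_left hT3 hl4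
    linarith
  have hΘ : T / ε * Re ≤ T / ε * (phi 4 * d 4 ^ 2 + phi 5 * d 5 ^ 2 + lam 4 * Rd) :=
    mul_le_mul_of_nonneg_left hT1 hTε'
  -- (i) dropped nonnegative terms
  have hdrop1 : 0 ≤ (s - 1) * (8 * Ra) := mul_nonneg hs1 (by positivity)
  have hdrop2 : 0 ≤ (s - 1) * (v * Rb) := mul_nonneg hs1 (mul_nonneg hv hRb0)
  have hdrop3 : 0 ≤ s * (v * Re) := mul_nonneg hs0 (mul_nonneg hv hRe0)
  have hcoup' : -(T * (ε * Rb + Re / ε)) = -(T * ε * Rb) - T / ε * Re := by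
    field_simp
    ring
  rw [hcoup'] at hcoup
  have e5 : (4 * s - T * lam 4 / ε) * Rd = 4 * s * Rd - T / ε * (lam 4 * Rd) := by ring
  rw [e5]
  linarith [hcoup, hW, hΘ, hdrop1, hdrop2, hdrop3]

end Summit.NavierStokesRegularity.TurbBounds.TailP2R0
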